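import Summits.NavierStokesRegularity.FluidComputer.SwirlTypeIBarrierMeridional
import Summits.NavierStokesRegularity.FluidComputer.ClayBreakdownAxisymmetricTypeII
import Summits.NavierStokesRegularity.FluidComputer.ClayBlowupLocalPoloidalAxisDecay
import HarnessLib

/-!
# NO LOCAL TYPE-I BOUND ON THE MERIDIONAL VELOCITY AT ANY SINGULAR POINT OF AN AXISYMMETRIC CLAY
# BLOW-UP — WITH ITS CLAY FORCE, UNCONDITIONALLY (Seregin–Šverák 2009, Thm 1.1 in its own
# `v̄`-phrasing (1.1), localised, with force; the «K8-v̄» gap of ECBRIDGE-2 MEMO-11 §3b closed)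

Cell `ns-blowup`, seat `ns-blowup-ecbridge-2` (g13; the E–C endpoint theory seat). LABEL: E–C typing
(KERNEL — no named fact, no new definition, NO conjecture hypothesis). WHAT THIS IS NOT: not
Navier–Stokes evidence — necessary conditions on the TYPE `ClayBlowup ν`; no inhabitant is claimed.
Companion memo: `run/shared/lean/pub/ns-blowup/ecbridge2/ECBRIDGE-2-MEMO-12.md`.

## Content

g12 proved the K8 row with the Clay force for the Type-I hypothesis on the FULL velocity
(`ClayBlowup.not_localTypeI_of_isAxisymmetric_forced`, KNSS 2009 Thm 6.2's phrasing), leaving the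
honest gap that Seregin–Šverák 2009 Thm 1.1 assumes the rate (1.1) `√(T − t)|v̄| ≤ C` on the
MERIDIONAL projection `v̄ = v_ϱ e_ϱ + v₃ e₃` only (arXiv:0804.1803 p. 2), the swirl being controlled
by the separate bound `|ϱ v_φ| ≤ C` (Lemma 3.3; for a Clay blow-up the tree's global swirl maximum
principle with force, g8 `ClayBlowup.swirl_bounded`) and the passage `v̄ ⇝ v` by the local energy
method (Lemma 3.5, Prop. 3.7). This file closes the gap by a DIFFERENT, elementary route: the swirl
barrier `exists_norm_le_typeI_of_meridionalTypeI` (`SwirlTypeIBarrierMeridional.lean`) — a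
parabolic comparison for `Γ = r u_θ` centred at axis points, in the similarity variable
`|x − c|/√(T − t)` — turns the meridional Type-I bound near an axis point into the full one:

* `ClayBlowup.exists_norm_force_le` — the Clay force is bounded (`(5)` with `K = 1`);
* **`ClayBlowup.eventually_localTypeI_of_localMeridionalTypeI`** (`ν > 0`, axisymmetric datum and
  force, `x₁` on the axis): `|ū(t, x)| ≤ C/√(T − t)` for `t` near `T`, `x ∈ B(x₁, r₀)` ⟹
  `|u(t, x)| ≤ C'/√(T − t)` for `t` near `T`, `x ∈ B(x₁, r₀/2)`;
* **`ClayBlowup.not_localMeridionalTypeI_of_isAxisymmetric_forced`** — at a point `x₁` which is not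
  backward bounded, for every `r₀ > 0` and `C`, the bound `|ū(t, x)| ≤ C/√(T − t)` for `t` near `T`,
  `x ∈ B(x₁, r₀)` FAILS; kill form `exists_gt_meridionalTypeI_near_of_isAxisymmetric`;
* **`ClayBlowup.not_meridionalTypeI_of_isAxisymmetric_clayForce`** — globally: no `C` with
  `|ū(t, x)| ≤ C/√(T − t)` for `t` near `T` and all `x`; `k8_row_meridional_clayForce` — the K8 row
  in Seregin–Šverák's own phrasing: NEITHER (1.1) `√(T − t)|ū| ≤ C` near `T` NOR (1.2) `ϱ|ū| ≤ C`
  holds (second clause: g12's `not_local_cylRadius_mul_poloidal_norm_le_of_isAxisymmetric`);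
* `DesignedBlowup` twins; the `(C)`-reading `ClayEvolution.axisymmetric_breakdown_meridionalTypeII`
  (every axisymmetric breakdown scenario for Fefferman's (C) is Type II EVEN IN THE MERIDIONAL
  SENSE, at every singular point).

References: Seregin–Šverák, Comm. PDE 34 (2009) = arXiv:0804.1803, §1 (1.1), Thm 1.1, p. 4,
Lemma 3.3 [cite: SereginSverak2009, §1 (1.1) and Thm 1.1]; Koch–Nadirashvili–Seregin–Šverák,
Acta Math. 203 (2009), Thm 6.2 [cite: KochNadirashviliSereginSverak2009, Thm 6.2];
C. L. Fefferman, (C), (5) [cite: FeffermanClay2006, (C)].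
-/

noncomputable section

namespace Summit.NavierStokesRegularity.FluidComputer

open Set MeasureTheory Filter Topology Function Metric
open scoped NNReal ContDiff
open Literature.Analysis Literature.Analysis.FluidPDE
open Summit.NavierStokesRegularity.NavierStokesRegularity

namespace ClayBlowup

variable {ν : ℝ} (X : ClayBlowup ν)

/-! ## §1 Inputs: the force is bounded; the swirl barrier on the type -/

/-- **The force of a Clay blow-up is bounded**: `|f(t, x)| ≤ F` for all `t ≥ 0`, `x`, some
`F ≥ 0` (Clay decay (5) with `n = 0`, `K = 1`: `(1 + |x| + t)|f(t, x)| ≤ C`).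
[cite: FeffermanClay2006, (5)] -/
theorem exists_norm_force_le :
    ∃ F : ℝ, 0 ≤ F ∧ ∀ t : ℝ, 0 ≤ t → ∀ x, ‖X.f t x‖ ≤ F := by
  obtain ⟨C, hC⟩ := X.force_decay 0 1
  have hC0 : 0 ≤ C := by
    have h := hC 0 le_rfl 0
    rw [pow_one] at h
    exact le_trans (mul_nonneg (by positivity) (norm_nonneg _)) h
  refine ⟨C, hC0, fun t ht x => ?_⟩
  have h := hC t ht x
  rw [pow_one, norm_iteratedFDerivWithin_zero] at h
  have h1 : ‖X.f t x‖ ≤ (1 + ‖x‖ + t) * ‖uncurry X.f (t, x)‖ := by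
    simp only [uncurry_apply_pair]
    have : (1 : ℝ) ≤ 1 + ‖x‖ + t := by linarith [norm_nonneg x]
    nlinarith [norm_nonneg (X.f t x)]
  exact h1.trans h

/-- **TYPE-I MERIDIONAL VELOCITY FORCES THE FULL TYPE-I BOUND NEAR THE AXIS, ON THE TYPE** (`ν > 0`;
axisymmetric datum and Clay force; `x₁` on the axis; no named fact): if `|ū(t, x)| ≤ C/√(T − t)` for
`t` near `T` and `x ∈ B(x₁, r₀)` (`ū = poloidalPart u`, the meridional part), then for some `C'`,
`|u(t, x)| ≤ C'/√(T − t)` for `t` near `T` and `x ∈ B(x₁, r₀/2)`. The swirl is bounded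
(`swirl_bounded`), the force is bounded (`exists_norm_force_le`), the velocity is bounded on closed
sub-slabs (`exists_norm_le`); the swirl barrier `exists_norm_le_typeI_of_meridionalTypeI` does the
rest, on `[t₀, T']` for every `T' < T` with constants independent of `T'`.
[cite: SereginSverak2009, §1 (1.1) and p. 4] -/
theorem eventually_localTypeI_of_localMeridionalTypeI (hν : 0 < ν) (h0A : IsAxisymmetric (X.u 0))
    (hfA : ∀ t ∈ Ico 0 X.T, IsAxisymmetric (X.f t)) {x₁ : EuclideanSpace ℝ (Fin 3)}
    (hx₁ : cylRadius x₁ = 0) {r₀ : ℝ} (hr₀ : 0 < r₀) {C : ℝ}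
    (h : ∀ᶠ t in 𝓝[<] X.T, ∀ x ∈ ball x₁ r₀,
      ‖poloidalPart (X.u t) x‖ ≤ C / Real.sqrt (X.T - t)) :
    ∃ C' : ℝ, ∀ᶠ t in 𝓝[<] X.T, ∀ x ∈ ball x₁ (r₀ / 2), ‖X.u t x‖ ≤ C' / Real.sqrt (X.T - t) := by
  have hT := X.T_pos
  have hax : ∀ t ∈ Ico 0 X.T, IsAxisymmetric (X.u t) := X.isAxisymmetric hν h0A hfA
  obtain ⟨t₁, ht₁T, hsub⟩ := mem_nhdsLT_iff_exists_Ioo_subset.1 h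
  have ht₁T' : t₁ < X.T := ht₁T
  -- the base time `t₀ ∈ (t₁, T) ∩ [T/2, T)`
  set t₀ : ℝ := max ((t₁ + X.T) / 2) (X.T / 2) with ht₀
  have ht₀T : t₀ < X.T := max_lt (by linarith [ht₁T']) (by linarith)
  have ht₀0 : 0 ≤ t₀ := le_trans (by linarith) (le_max_right _ _)
  have ht₁t₀ : t₁ < t₀ := lt_of_lt_of_le (by linarith [ht₁T']) (le_max_left _ _)
  -- the constants
  set C₁ : ℝ := max C 0 with hC₁
  have hC₁0 : 0 ≤ C₁ := le_max_right _ _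
  obtain ⟨CΓ, hCΓ0, hΓ⟩ := X.swirl_bounded hν h0A hfA
  obtain ⟨B, hB⟩ := X.exists_norm_le hν ht₀T
  have hB0 : 0 ≤ B := (norm_nonneg _).trans (hB 0 ⟨le_rfl, ht₀0⟩ 0)
  obtain ⟨F, hF0, hF⟩ := X.exists_norm_force_le
  obtain ⟨C', -, hmain⟩ := exists_norm_le_typeI_of_meridionalTypeI (T := X.T) (t₀ := t₀) hν ht₀T
    hC₁0 hCΓ0 hB0 hF0 hr₀
  refine ⟨C', ?_⟩
  rw [Filter.eventually_iff_exists_mem]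
  refine ⟨Ioo t₀ X.T, Ioo_mem_nhdsLT ht₀T, fun T' hT' x hx => ?_⟩
  -- apply the barrier on `[t₀, T']`
  have hsubI : Icc t₀ T' ⊆ Ico 0 X.T := fun s hs => ⟨ht₀0.trans hs.1, hs.2.trans_lt hT'.2⟩
  have hcl : IsClassicalNSSolutionOn (Icc t₀ T') ν X.f X.u X.p :=
    X.classical.mono hsubI (uniqueDiffOn_Icc hT'.1)
  have hmer : ∀ t ∈ Icc t₀ T', ∀ y ∈ ball x₁ r₀,
      ‖poloidalPart (X.u t) y‖ ≤ C₁ / Real.sqrt (X.T - t) := by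
    intro t ht y hy
    have ht' : t ∈ Ioo t₁ X.T := ⟨ht₁t₀.trans_le ht.1, ht.2.trans_lt hT'.2⟩
    exact (hsub ht' y hy).trans
      (div_le_div_of_nonneg_right (le_max_left _ _) (Real.sqrt_nonneg _))
  exact hmain T' X.u X.f X.p x₁ hT'.1 hT'.2 hcl (fun t ht => hax t (hsubI ht))
    (fun t ht => hfA t (hsubI ht)) hx₁ hmer (fun t ht y _ => hΓ t (hsubI ht) y)
    (fun y _ => hB t₀ ⟨ht₀0, le_rfl⟩ y) (fun t ht y _ => hF t (ht₀0.trans ht.1) y)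
    T' ⟨hT'.1.le, le_rfl⟩ x hx

/-! ## §2 No local meridional Type-I bound at any singular point (every `ν`) -/

/-- **NO LOCAL TYPE-I BOUND ON THE MERIDIONAL VELOCITY AT ANY SINGULAR POINT OF AN AXISYMMETRIC CLAY
BLOW-UP — WITH ITS CLAY FORCE, UNCONDITIONALLY** (`ν > 0`; axisymmetric datum and axisymmetric Clay
force; no named fact, no conjecture): at a point `x₁` which is not backward bounded at `T`, for every
`r₀ > 0` and every `C`, the bound `|ū(t, x)| ≤ C/√(T − t)` (`ū = poloidalPart u = u − u_θ e_θ`, the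
meridional part `v̄ = v_ϱ e_ϱ + v₃ e₃` of Seregin–Šverák's (1.1)) for `t` near `T` and `x ∈ B(x₁, r₀)`
FAILS: it would give the full local Type-I bound on `B(x₁, r₀/2)`
(`eventually_localTypeI_of_localMeridionalTypeI`), excluded by g12's
`not_localTypeI_of_isAxisymmetric_forced`. [cite: SereginSverak2009, Thm 1.1 with (1.1)]
[cite: KochNadirashviliSereginSverak2009, Thm 6.2] -/
theorem not_localMeridionalTypeI_of_isAxisymmetric_forced (hν : 0 < ν)
    (h0A : IsAxisymmetric (X.u 0)) (hfA : ∀ t ∈ Ico 0 X.T, IsAxisymmetric (X.f t))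
    {x₁ : EuclideanSpace ℝ (Fin 3)} (hx₁ : ¬ IsBackwardBoundedAt X.u X.T x₁) {r₀ : ℝ} (hr₀ : 0 < r₀)
    (C : ℝ) :
    ¬ ∀ᶠ t in 𝓝[<] X.T, ∀ x ∈ ball x₁ r₀,
      ‖poloidalPart (X.u t) x‖ ≤ C / Real.sqrt (X.T - t) := by
  intro h
  have hx₁ax : cylRadius x₁ = 0 := X.cylRadius_eq_zero_of_not_isBackwardBoundedAt hν h0A hfA hx₁
  obtain ⟨C', hC'⟩ := X.eventually_localTypeI_of_localMeridionalTypeI hν h0A hfA hx₁ax hr₀ h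
  exact X.not_localTypeI_of_isAxisymmetric_forced hν h0A hfA hx₁ (half_pos hr₀) C' hC'

/-- **Every singular point of an axisymmetric Clay blow-up is a point of LOCAL MERIDIONAL TYPE II
GROWTH, with the force** (`ν > 0`): for every `r₀ > 0`, `C` and `t₀ < T` there are `t ∈ (t₀, T)`,
`x ∈ B(x₁, r₀)` with `|ū(t, x)| > C/√(T − t)`. [cite: SereginSverak2009, Thm 1.1 with (1.1)] -/
theorem exists_gt_meridionalTypeI_near_of_isAxisymmetric (hν : 0 < ν)
    (h0A : IsAxisymmetric (X.u 0)) (hfA : ∀ t ∈ Ico 0 X.T, IsAxisymmetric (X.f t))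
    {x₁ : EuclideanSpace ℝ (Fin 3)} (hx₁ : ¬ IsBackwardBoundedAt X.u X.T x₁) {r₀ : ℝ} (hr₀ : 0 < r₀)
    (C : ℝ) {t₀ : ℝ} (ht₀ : t₀ < X.T) :
    ∃ t ∈ Ioo t₀ X.T, ∃ x ∈ ball x₁ r₀,
      C / Real.sqrt (X.T - t) < ‖poloidalPart (X.u t) x‖ := by
  by_contra hcon
  push Not at hcon
  refine X.not_localMeridionalTypeI_of_isAxisymmetric_forced hν h0A hfA hx₁ hr₀ C ?_
  filter_upwards [Ioo_mem_nhdsLT ht₀] with t ht x hx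
  exact hcon t ht x hx

/-! ## §3 The global row in Seregin–Šverák's phrasing -/

/-- **AN AXISYMMETRIC CLAY BLOW-UP — WITH ITS CLAY FORCE — IS TYPE II EVEN IN THE MERIDIONAL SENSE,
UNCONDITIONALLY** (`ν > 0`; axisymmetric datum and Clay force): there is no `C` with
`|ū(t, x)| ≤ C/√(T − t)` for `t` near `T` and all `x` — the meridional rate (1.1) of
Seregin–Šverák 2009 fails (a global bound is a local one at the singular point of
`exists_not_isBackwardBoundedAt`). Strengthens g12's `not_typeI_of_isAxisymmetric_clayForce`
(`|ū| ≤ |u|`). [cite: SereginSverak2009, Thm 1.1 with (1.1)] -/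
theorem not_meridionalTypeI_of_isAxisymmetric_clayForce (hν : 0 < ν)
    (h0A : IsAxisymmetric (X.u 0)) (hfA : ∀ t ∈ Ico 0 X.T, IsAxisymmetric (X.f t)) :
    ¬ ∃ C : ℝ, ∀ᶠ t in 𝓝[<] X.T, ∀ x : EuclideanSpace ℝ (Fin 3),
      ‖poloidalPart (X.u t) x‖ ≤ C / Real.sqrt (X.T - t) := by
  rintro ⟨C, hC⟩
  obtain ⟨x₁, hx₁⟩ := X.exists_not_isBackwardBoundedAt hν
  refine X.not_localMeridionalTypeI_of_isAxisymmetric_forced hν h0A hfA hx₁ one_pos C ?_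
  filter_upwards [hC] with t ht x _ using ht x

/-- **THE K8 ROW WITH THE CLAY FORCE IN SEREGIN–ŠVERÁK'S OWN PHRASING** (`ν > 0`, axisymmetric datum
and force): NEITHER the meridional Type-I rate (1.1) `|ū(t, x)| ≤ C/√(T − t)` near `T` NOR the
meridional axis-weighted bound (1.2) `ϱ |ū(t, x)| ≤ C` on `[0, T) × ℝ³` holds (second clause:
g12's local poloidal form of KNSS Thm 6.1 / Seregin–Šverák Thm 1.2 with force at the singular point
of `exists_not_isBackwardBoundedAt`). [cite: SereginSverak2009, Thms 1.1–1.2 with (1.1)–(1.2)] -/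
theorem k8_row_meridional_clayForce (hν : 0 < ν) (h0A : IsAxisymmetric (X.u 0))
    (hfA : ∀ t ∈ Ico 0 X.T, IsAxisymmetric (X.f t)) :
    (¬ ∃ C : ℝ, ∀ᶠ t in 𝓝[<] X.T, ∀ x : EuclideanSpace ℝ (Fin 3),
        ‖poloidalPart (X.u t) x‖ ≤ C / Real.sqrt (X.T - t)) ∧
      ¬ ∃ C : ℝ, ∀ t ∈ Ico 0 X.T, ∀ x : EuclideanSpace ℝ (Fin 3),
        cylRadius x * ‖poloidalPart (X.u t) x‖ ≤ C := by
  refine ⟨X.not_meridionalTypeI_of_isAxisymmetric_clayForce hν h0A hfA, ?_⟩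
  rintro ⟨C, hC⟩
  obtain ⟨x₁, hx₁⟩ := X.exists_not_isBackwardBoundedAt hν
  exact X.not_local_cylRadius_mul_poloidal_norm_le_of_isAxisymmetric hν h0A hfA hx₁ one_pos
    X.T_pos ⟨C, fun t ht x _ => hC t ⟨ht.1.le, ht.2⟩ x⟩

end ClayBlowup

/-! ## §4 Designed blow-ups and the (C)-reading -/

/-- **No local meridional Type-I bound at any singular point of an axisymmetric designed blow-up,
with its force.** [cite: SereginSverak2009, Thm 1.1 with (1.1)] -/
theorem DesignedBlowup.not_localMeridionalTypeI_of_isAxisymmetric {ν : ℝ} (D : DesignedBlowup ν)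
    (hν : 0 < ν) (h0A : IsAxisymmetric (D.u 0)) (hfA : ∀ t ∈ Ico 0 D.T, IsAxisymmetric (D.f t))
    {x₁ : EuclideanSpace ℝ (Fin 3)} (hx₁ : ¬ IsBackwardBoundedAt D.u D.T x₁) {r₀ : ℝ} (hr₀ : 0 < r₀)
    (C : ℝ) :
    ¬ ∀ᶠ t in 𝓝[<] D.T, ∀ x ∈ ball x₁ r₀,
      ‖poloidalPart (D.u t) x‖ ≤ C / Real.sqrt (D.T - t) :=
  D.toClayBlowup.not_localMeridionalTypeI_of_isAxisymmetric_forced hν h0A hfA hx₁ hr₀ C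

/-- **An axisymmetric designed blow-up is Type II in the meridional sense, unconditionally.**
[cite: SereginSverak2009, Thm 1.1 with (1.1)] -/
theorem DesignedBlowup.not_meridionalTypeI_of_isAxisymmetric_clayForce {ν : ℝ} (D : DesignedBlowup ν)
    (hν : 0 < ν) (h0A : IsAxisymmetric (D.u 0)) (hfA : ∀ t ∈ Ico 0 D.T, IsAxisymmetric (D.f t)) :
    ¬ ∃ C : ℝ, ∀ᶠ t in 𝓝[<] D.T, ∀ x : EuclideanSpace ℝ (Fin 3),
      ‖poloidalPart (D.u t) x‖ ≤ C / Real.sqrt (D.T - t) :=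
  D.toClayBlowup.not_meridionalTypeI_of_isAxisymmetric_clayForce hν h0A hfA

/-- **THE (C)-READING: EVERY AXISYMMETRIC BREAKDOWN SCENARIO FOR FEFFERMAN'S (C) IS TYPE II EVEN IN
THE MERIDIONAL SENSE.** If a smooth divergence-free rapidly decaying axisymmetric datum `u₀` and a
Clay force `f`, axisymmetric for `t ≥ 0`, admit NO Clay solution (i.e. certify (C)), then the finite-
energy classical evolution is a Clay blow-up `B` from `(u₀, f)` whose meridional velocity violates
the Type-I rate globally AND locally at every singular point, all of which lie on the axis. Nothing
here says such a scenario exists. [cite: FeffermanClay2006, (C)] [cite: SereginSverak2009, Thm 1.1] -/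
theorem ClayEvolution.axisymmetric_breakdown_meridionalTypeII {ν : ℝ} (hν : 0 < ν)
    {u₀ : EuclideanSpace ℝ (Fin 3) → EuclideanSpace ℝ (Fin 3)}
    {f : ℝ → EuclideanSpace ℝ (Fin 3) → EuclideanSpace ℝ (Fin 3)}
    (hu₀ : ContDiff ℝ ∞ u₀) (hdiv : NSWave0.IsDivFree u₀) (hdec : HasRapidSpatialDecay u₀)
    (hs : IsSmoothOnHalfSpace f) (hd : HasRapidSpaceTimeDecay f)
    (h0A : IsAxisymmetric u₀) (hfA : ∀ t, 0 ≤ t → IsAxisymmetric (f t))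
    (hno : ¬ ∃ (u : ℝ → EuclideanSpace ℝ (Fin 3) → EuclideanSpace ℝ (Fin 3))
        (p : ℝ → EuclideanSpace ℝ (Fin 3) → ℝ),
        IsSmoothOnHalfSpace u ∧ IsSmoothOnHalfSpace p ∧
          IsNavierStokesSolution ν f u₀ u p ∧ HasBoundedEnergy u) :
    ∃ B : ClayBlowup ν, B.u 0 = u₀ ∧ B.f = f ∧
      (¬ ∃ C : ℝ, ∀ᶠ t in 𝓝[<] B.T, ∀ x : EuclideanSpace ℝ (Fin 3),
          ‖poloidalPart (B.u t) x‖ ≤ C / Real.sqrt (B.T - t)) ∧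
      (∃ x₁ : EuclideanSpace ℝ (Fin 3), ¬ IsBackwardBoundedAt B.u B.T x₁) ∧
      ∀ x₁ : EuclideanSpace ℝ (Fin 3), ¬ IsBackwardBoundedAt B.u B.T x₁ →
        cylRadius x₁ = 0 ∧ ∀ r₀ : ℝ, 0 < r₀ → ∀ C : ℝ,
          ¬ ∀ᶠ t in 𝓝[<] B.T, ∀ x ∈ ball x₁ r₀,
            ‖poloidalPart (B.u t) x‖ ≤ C / Real.sqrt (B.T - t) := by
  rcases ClayEvolution.exists_claySolution_or_clayBlowup hν hu₀ hdiv hdec hs hd with hsol | ⟨B, hB0, hBf⟩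
  · exact absurd hsol hno
  have h0A' : IsAxisymmetric (B.u 0) := by rw [hB0]; exact h0A
  have hfA' : ∀ t ∈ Ico 0 B.T, IsAxisymmetric (B.f t) := fun t ht => by rw [hBf]; exact hfA t ht.1
  refine ⟨B, hB0, hBf, B.not_meridionalTypeI_of_isAxisymmetric_clayForce hν h0A' hfA',
    B.exists_not_isBackwardBoundedAt hν, fun x₁ hx₁ => ⟨?_, fun r₀ hr₀ C => ?_⟩⟩
  · exact B.cylRadius_eq_zero_of_not_isBackwardBoundedAt hν h0A' hfA' hx₁
  · exact B.not_localMeridionalTypeI_of_isAxisymmetric_forced hν h0A' hfA' hx₁ hr₀ C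

end Summit.NavierStokesRegularity.FluidComputer

end

/-! ## §5 Appendix (g13, append-only): the swirl is Type-I-slaved to the meridional field; the
meridional portrait of a singular point; filter forms -/

noncomputable section

namespace Summit.NavierStokesRegularity.FluidComputer

open Set MeasureTheory Filter Topology Function Metric
open scoped NNReal ContDiff
open Literature.Analysis Literature.Analysis.FluidPDE
open Summit.NavierStokesRegularity.NavierStokesRegularity

namespace ClayBlowup

variable {ν : ℝ} (X : ClayBlowup ν)

/-- **THE SWIRL VELOCITY OF AN AXISYMMETRIC CLAY BLOW-UP IS TYPE-I-SLAVED TO THE MERIDIONAL FIELD**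
(`ν > 0`; axisymmetric datum and Clay force; `x₁` on the axis): a meridional Type-I bound
`|ū(t, x)| ≤ C/√(T − t)` for `t` near `T`, `x ∈ B(x₁, r₀)` forces the swirl velocity to obey
`|u_θ(t, x)| ≤ C'/√(T − t)` for `t` near `T`, `x ∈ B(x₁, r₀/2)` (`|u_θ| ≤ |u|` and
`eventually_localTypeI_of_localMeridionalTypeI`). Read contrapositively at a singular point: the swirl
can beat the Type-I rate only where the meridional inflow/updraft already does.
[cite: SereginSverak2009, §1 (1.1) and p. 4] -/
theorem eventually_swirlVelocity_typeI_of_localMeridionalTypeI (hν : 0 < ν)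
    (h0A : IsAxisymmetric (X.u 0)) (hfA : ∀ t ∈ Ico 0 X.T, IsAxisymmetric (X.f t))
    {x₁ : EuclideanSpace ℝ (Fin 3)} (hx₁ : cylRadius x₁ = 0) {r₀ : ℝ} (hr₀ : 0 < r₀) {C : ℝ}
    (h : ∀ᶠ t in 𝓝[<] X.T, ∀ x ∈ ball x₁ r₀,
      ‖poloidalPart (X.u t) x‖ ≤ C / Real.sqrt (X.T - t)) :
    ∃ C' : ℝ, ∀ᶠ t in 𝓝[<] X.T, ∀ x ∈ ball x₁ (r₀ / 2),
      |swirlVelocity (X.u t) x| ≤ C' / Real.sqrt (X.T - t) := by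
  obtain ⟨C', hC'⟩ := X.eventually_localTypeI_of_localMeridionalTypeI hν h0A hfA hx₁ hr₀ h
  refine ⟨C', ?_⟩
  filter_upwards [hC'] with t ht x hx
  exact (SereginSverak2009.abs_swirlVelocity_le_norm (X.u t) x).trans (ht x hx)

/-- **Filter form of the meridional Type-II growth** (`ν > 0`, axisymmetric datum and Clay force):
at a point `x₁` which is not backward bounded, for every `r₀ > 0` and `C`, FREQUENTLY as `t ↑ T`
some `x ∈ B(x₁, r₀)` has `|ū(t, x)| > C/√(T − t)`. [cite: SereginSverak2009, Thm 1.1 with (1.1)] -/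
theorem frequently_gt_meridionalTypeI_of_isAxisymmetric (hν : 0 < ν)
    (h0A : IsAxisymmetric (X.u 0)) (hfA : ∀ t ∈ Ico 0 X.T, IsAxisymmetric (X.f t))
    {x₁ : EuclideanSpace ℝ (Fin 3)} (hx₁ : ¬ IsBackwardBoundedAt X.u X.T x₁) {r₀ : ℝ} (hr₀ : 0 < r₀)
    (C : ℝ) :
    ∃ᶠ t in 𝓝[<] X.T, ∃ x ∈ ball x₁ r₀,
      C / Real.sqrt (X.T - t) < ‖poloidalPart (X.u t) x‖ := by
  have h := X.not_localMeridionalTypeI_of_isAxisymmetric_forced hν h0A hfA hx₁ hr₀ C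
  rw [Filter.not_eventually] at h
  refine h.mono fun t ht => ?_
  push Not at ht
  exact ht

/-- **THE MERIDIONAL PORTRAIT OF A SINGULAR POINT OF AN AXISYMMETRIC CLAY BLOW-UP, WITH THE FORCE**
(`ν > 0`; one name for the census): a point `x₁` which is not backward bounded at `T` (i) lies on the
axis; (ii) admits no local Type-I bound on the meridional velocity `ū` in any ball around it
(Seregin–Šverák (1.1) fails locally); (iii) admits no local bound `ϱ |ū| ≤ C` in any ball around it on
any final time interval (Seregin–Šverák (1.2) fails locally; g12); (iv) admits no local Type-I bound on
the full velocity (g12). [cite: SereginSverak2009, Thms 1.1–1.2 with (1.1)–(1.2)]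
[cite: KochNadirashviliSereginSverak2009, Thms 6.1–6.2] -/
theorem axisymmetric_singularPoint_portrait_meridional (hν : 0 < ν)
    (h0A : IsAxisymmetric (X.u 0)) (hfA : ∀ t ∈ Ico 0 X.T, IsAxisymmetric (X.f t))
    {x₁ : EuclideanSpace ℝ (Fin 3)} (hx₁ : ¬ IsBackwardBoundedAt X.u X.T x₁) :
    cylRadius x₁ = 0 ∧
      (∀ r₀ : ℝ, 0 < r₀ → ∀ C : ℝ, ¬ ∀ᶠ t in 𝓝[<] X.T, ∀ x ∈ ball x₁ r₀,
        ‖poloidalPart (X.u t) x‖ ≤ C / Real.sqrt (X.T - t)) ∧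
      (∀ r₀ : ℝ, 0 < r₀ → ∀ t₀ : ℝ, t₀ < X.T → ¬ ∃ C : ℝ, ∀ t ∈ Ioo t₀ X.T, ∀ x ∈ ball x₁ r₀,
        cylRadius x * ‖poloidalPart (X.u t) x‖ ≤ C) ∧
      (∀ r₀ : ℝ, 0 < r₀ → ∀ C : ℝ, ¬ ∀ᶠ t in 𝓝[<] X.T, ∀ x ∈ ball x₁ r₀,
        ‖X.u t x‖ ≤ C / Real.sqrt (X.T - t)) :=
  ⟨X.cylRadius_eq_zero_of_not_isBackwardBoundedAt hν h0A hfA hx₁,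
    fun _ hr₀ C => X.not_localMeridionalTypeI_of_isAxisymmetric_forced hν h0A hfA hx₁ hr₀ C,
    fun _ hr₀ _ ht₀ => X.not_local_cylRadius_mul_poloidal_norm_le_of_isAxisymmetric hν h0A hfA hx₁ hr₀ ht₀,
    fun _ hr₀ C => X.not_localTypeI_of_isAxisymmetric_forced hν h0A hfA hx₁ hr₀ C⟩

/-- **Existence form**: every axisymmetric Clay blow-up (`ν > 0`, axisymmetric datum and force) HAS a
point on the axis with the meridional portrait — in particular an axis point around which
`√(T − t) |ū|` is unbounded in every ball (the meridional Type-II point Seregin–Šverák's Theorem 1.1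
demands of any genuine axisymmetric singularity, here WITH the Clay force).
[cite: SereginSverak2009, Thm 1.1 with (1.1)] -/
theorem exists_axisPoint_meridionalTypeII (hν : 0 < ν) (h0A : IsAxisymmetric (X.u 0))
    (hfA : ∀ t ∈ Ico 0 X.T, IsAxisymmetric (X.f t)) :
    ∃ x₁ : EuclideanSpace ℝ (Fin 3), cylRadius x₁ = 0 ∧ ¬ IsBackwardBoundedAt X.u X.T x₁ ∧
      ∀ r₀ : ℝ, 0 < r₀ → ∀ C : ℝ, ¬ ∀ᶠ t in 𝓝[<] X.T, ∀ x ∈ ball x₁ r₀,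
        ‖poloidalPart (X.u t) x‖ ≤ C / Real.sqrt (X.T - t) := by
  obtain ⟨x₁, hx₁⟩ := X.exists_not_isBackwardBoundedAt hν
  exact ⟨x₁, X.cylRadius_eq_zero_of_not_isBackwardBoundedAt hν h0A hfA hx₁, hx₁,
    fun _ hr₀ C => X.not_localMeridionalTypeI_of_isAxisymmetric_forced hν h0A hfA hx₁ hr₀ C⟩

end ClayBlowup

/-- **DesignedBlowup twin of the meridional portrait.** [cite: SereginSverak2009, Thms 1.1–1.2] -/
theorem DesignedBlowup.exists_axisPoint_meridionalTypeII {ν : ℝ} (D : DesignedBlowup ν) (hν : 0 < ν)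
    (h0A : IsAxisymmetric (D.u 0)) (hfA : ∀ t ∈ Ico 0 D.T, IsAxisymmetric (D.f t)) :
    ∃ x₁ : EuclideanSpace ℝ (Fin 3), cylRadius x₁ = 0 ∧ ¬ IsBackwardBoundedAt D.u D.T x₁ ∧
      ∀ r₀ : ℝ, 0 < r₀ → ∀ C : ℝ, ¬ ∀ᶠ t in 𝓝[<] D.T, ∀ x ∈ ball x₁ r₀,
        ‖poloidalPart (D.u t) x‖ ≤ C / Real.sqrt (D.T - t) :=
  D.toClayBlowup.exists_axisPoint_meridionalTypeII hν h0A hfA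

end Summit.NavierStokesRegularity.FluidComputer

end
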